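import Summits.HubbardSuperconductivity.HubbardSuperconductivity.Theorems.LevyLogBootstrapLevyTransportLevyBootstrap
import Summits.HubbardSuperconductivity.HubbardSuperconductivity.Theorems.LevyLogBootstrapLevyTransportStubLevyFloor
import HarnessLib

/-!
# Crux `LevyTransport` (stmt-HubbardSuperconductivity-15049, route `LevyLogBootstrap`):
# the layer-2 interface of `stub_logBootstrap` — what the physics must still supply

With the Lévy bootstrap lemma along ground states landed (`stub_levyBootstrapShape`), the
load-bearing stub `stub_logBootstrap` of the birth skeleton reduces to M-UNIFORM bounds on two
functionals of the coarse 2×2-block kernel `k₂` — the local log-decoherence `U` and the infrared wing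
`β` — plus the anchor at the KLS point and the numerical compatibility of the constants:
* `transverseKernel_le_half` / `transverseKernel_le_half_all` (registered sub-goal) —
  `Re⟨ψ, S⁺_x S⁻_y ψ⟩ ≤ ½` at half filling (`2 Re⟨u,v⟩ ≤ ‖u‖² + ‖v‖²`, `‖S⁻_zψ‖² = ½`); hence
  `coarseKernel_le_eight` — `k₂(X) ≤ 8`;
* `logBootstrap_explicit_of_inputs` — for `Δ₁ ∈ (-1, 0]`, a cosine threshold `t < 1` (UV set
  `S = {q ≠ 0 : ∃ i, Re χ_q(e_i) ≤ t}`, infrared box its complement) and constants `U₀`, `β₀ ≥ 0`,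
  `M₀`: IF (a) `(Σ_{q ∉ S, q ≠ 0} k̂₂(q))/(n² k₂(0)) ≤ β₀` (INFRARED WING, Gaussian domination),
  (b) `(Σ_i (log k₂(0) - log k₂(e_i)))/(1 - t) ≤ U₀` (LOCAL log-coherence), (c) `levyMass ≤ U₀ + 1`
  at `Δ = 0` (ANCHOR), for even `M ≥ M₀` and half-filled ground states on `[Δ₁, 0]`, and
  (d) `β₀ e^{U₀+1} < 1`, THEN (given `Block2InfDivXXZ`) the body of `stub_logBootstrap` holds at `Δ₁`
  with `U = U₀`, `β = β₀`;
* `local_logCoherence_le_of_lower` — (b) from a LOWER bound `k₂(e_i) ≥ ℓ > 0`;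
* `levyMass_le_of_pointwise_lower` — (c) from a POINTWISE anchor `k₂(X) ≥ c₀ > 0`.

Sources: Kennedy–Lieb–Shastry (1988); Dyson–Lieb–Simon (1978); Berg–Christensen–Ressel (1984)
Ch. 3–4; G. Slade (2006) Lemma 5.9; skeleton `Cruxes/LevyTransport/Lines/birth.lean` (P1–P5).
No definition is introduced; sorry-free.
-/

noncomputable section

set_option linter.dupNamespace false

namespace Summit.HubbardSuperconductivity.HubbardSuperconductivity.Theorems.LevyLogBootstrap

open scoped BigOperators Matrix ComplexOrder ComplexConjugate
open Matrix Finset Complex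
open Literature.MathematicalPhysics.QuantumLattice Literature.Probability.LatticeModels

/-! ### The transverse kernel is bounded by `½`; the coarse block kernel by `8` -/

section Bounds

variable (M : ℕ) {m : ℕ} [NeZero M] [NeZero m]

/-- `2 Re⟨u, v⟩ ≤ ‖u‖² + ‖v‖²` for complex vectors (`0 ≤ ‖u - v‖²`), in dot-product form. [folklore] -/
theorem two_mul_re_star_dotProduct_le_add {ι : Type*} [Fintype ι] (u v : ι → ℂ) :
    2 * (star u ⬝ᵥ v).re ≤ (star u ⬝ᵥ u).re + (star v ⬝ᵥ v).re := by
  have h0 : 0 ≤ (star (u - v) ⬝ᵥ (u - v)).re :=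
    (Complex.nonneg_iff.mp (dotProduct_star_self_nonneg (u - v))).1
  have hexp : star (u - v) ⬝ᵥ (u - v) =
      star u ⬝ᵥ u - star u ⬝ᵥ v - star v ⬝ᵥ u + star v ⬝ᵥ v := by
    rw [star_sub, sub_dotProduct, dotProduct_sub, dotProduct_sub]
    ring
  have hconj : star v ⬝ᵥ u = conj (star u ⬝ᵥ v) := by
    rw [← Complex.star_def, star_dotProduct]
  rw [hexp, hconj] at h0
  simp only [Complex.add_re, Complex.sub_re, Complex.conj_re] at h0
  linarith

/-- **The transverse kernel of a half-filled sector ground state is at most `½`**: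
`Re⟨ψ, S⁺_x S⁻_y ψ⟩ ≤ ½` (even `M`). With `u = S⁻_x ψ`, `v = S⁻_y ψ`:
`⟨ψ, S⁺_x S⁻_y ψ⟩ = ⟨u, v⟩`, `2 Re⟨u,v⟩ ≤ ‖u‖² + ‖v‖²` and `‖S⁻_z ψ‖² = Re⟨ψ, S⁺_z S⁻_z ψ⟩ = ½`
(`LevyFloor.transverseKernel_diag`). [folklore] -/
theorem transverseKernel_le_half (hEven : Even M) (Δ : ℝ)
    (ψ : TensorIndex (TorusSite 2 M) 2 → ℂ)
    (hψ : ψ ∈ @spinZSector (TorusSite 2 M) _ _ 1 0) (hnorm : star ψ ⬝ᵥ ψ = 1)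
    (heig : Matrix.mulVec (xxzHamiltonian 1 (torusGraph 2 M) (-1) Δ) ψ =
      ((lowestEnergyInSector 1 (xxzHamiltonian 1 (torusGraph 2 M) (-1) Δ) 0 : ℝ) : ℂ) • ψ)
    (x y : TorusSite 2 M) :
    (star ψ ⬝ᵥ Matrix.mulVec (onSite x (spinRaise 1) * onSite y (spinLower 1)) ψ).re ≤ 1 / 2 := by
  -- `⟨ψ, S⁺_a S⁻_b ψ⟩ = ⟨S⁻_a ψ, S⁻_b ψ⟩`
  have hraise : ∀ a : TorusSite 2 M,
      (onSite a (spinRaise 1) : Op (TorusSite 2 M) 2) = (onSite a (spinLower 1))ᴴ := fun a => by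
    rw [← onSite_conjTranspose, spinLower_eq_conjTranspose, conjTranspose_conjTranspose]
  have hinner : ∀ a b : TorusSite 2 M,
      star ψ ⬝ᵥ Matrix.mulVec (onSite a (spinRaise 1) * onSite b (spinLower 1)) ψ =
        star (onSite a (spinLower 1) *ᵥ ψ) ⬝ᵥ (onSite b (spinLower 1) *ᵥ ψ) := fun a b => by
    rw [hraise a, ← mulVec_mulVec, dotProduct_mulVec, star_mulVec]
  have hdiag : ∀ a : TorusSite 2 M,
      (star (onSite a (spinLower 1) *ᵥ ψ) ⬝ᵥ (onSite a (spinLower 1) *ᵥ ψ)).re = 1 / 2 := fun a => by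
    rw [← hinner a a]
    exact LevyFloor.transverseKernel_diag M hEven Δ ψ hψ hnorm heig a
  have h2 := two_mul_re_star_dotProduct_le_add (onSite x (spinLower 1) *ᵥ ψ)
    (onSite y (spinLower 1) *ᵥ ψ)
  rw [hdiag x, hdiag y, ← hinner x y] at h2
  linarith

/-- **`transverseKernel_le_half_all`** (registered sub-goal of stmt-HubbardSuperconductivity-15049, the
M-uniform upper bound behind inputs (b)/(c) of `stub_logBootstrap`): for every even `M`, every real
`Δ` and every normalised `S^z_tot = 0` sector ground state `ψ` of
`xxzHamiltonian 1 (torusGraph 2 M) (-1) Δ`, `Re⟨ψ, S⁺_x S⁻_y ψ⟩ ≤ ½` for all sites `x, y`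
(`transverseKernel_le_half`, closed form). [folklore] -/
theorem transverseKernel_le_half_all :
    ∀ (M : ℕ) [NeZero M], Even M → ∀ (Δ : ℝ) (ψ : TensorIndex (TorusSite 2 M) 2 → ℂ),
      ψ ∈ @spinZSector (TorusSite 2 M) _ _ 1 0 → star ψ ⬝ᵥ ψ = 1 →
      Matrix.mulVec (xxzHamiltonian 1 (torusGraph 2 M) (-1) Δ) ψ =
        ((lowestEnergyInSector 1 (xxzHamiltonian 1 (torusGraph 2 M) (-1) Δ) 0 : ℝ) : ℂ) • ψ →
      ∀ x y : TorusSite 2 M,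
        (star ψ ⬝ᵥ Matrix.mulVec (onSite x (spinRaise 1) * onSite y (spinLower 1)) ψ).re ≤ 1 / 2 :=
  fun M _ hEven Δ ψ hψ hnorm heig x y => transverseKernel_le_half M hEven Δ ψ hψ hnorm heig x y

/-- **The coarse 2×2-block kernel is at most `8`**: `k₂(X) ≤ 16 · ½` (each of the `4 × 4` terms of
the block sum is `≤ ½`, `LevyFloor.card_filter_block`). [folklore] -/
theorem coarseKernel_le_eight (hM : M = 2 * m) (hEven : Even M) (Δ : ℝ)
    (ψ : TensorIndex (TorusSite 2 M) 2 → ℂ)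
    (hψ : ψ ∈ @spinZSector (TorusSite 2 M) _ _ 1 0) (hnorm : star ψ ⬝ᵥ ψ = 1)
    (heig : Matrix.mulVec (xxzHamiltonian 1 (torusGraph 2 M) (-1) Δ) ψ =
      ((lowestEnergyInSector 1 (xxzHamiltonian 1 (torusGraph 2 M) (-1) Δ) 0 : ℝ) : ℂ) • ψ)
    (X : TorusSite 2 m) :
    (∑ x' : TorusSite 2 M, ∑ y' : TorusSite 2 M,
      if (∀ i : Fin 2, (x' i).val / 2 = (X i).val) ∧ (∀ i : Fin 2, (y' i).val / 2 = 0) then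
        (star ψ ⬝ᵥ Matrix.mulVec (onSite x' (spinRaise 1) * onSite y' (spinLower 1)) ψ).re
      else 0) ≤ 8 := by
  classical
  have hK : ∀ x' y' : TorusSite 2 M,
      (star ψ ⬝ᵥ Matrix.mulVec (onSite x' (spinRaise 1) * onSite y' (spinLower 1)) ψ).re ≤ 1 / 2 :=
    transverseKernel_le_half M hEven Δ ψ hψ hnorm heig
  have hXlt : ∀ i : Fin 2, (X i).val < M / 2 := fun i => by
    have := ZMod.val_lt (X i)
    omega
  have h0lt : ∀ _i : Fin 2, (0 : ℕ) < M / 2 := fun _ => by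
    have := NeZero.ne m
    omega
  have hcardX : (Finset.univ.filter (fun x' : TorusSite 2 M => ∀ i : Fin 2, (x' i).val / 2 = (X i).val)).card
      = 4 := LevyFloor.card_filter_block M hEven (fun i => (X i).val) hXlt
  have hcard0 : (Finset.univ.filter (fun y' : TorusSite 2 M => ∀ i : Fin 2, (y' i).val / 2 = 0)).card
      = 4 := LevyFloor.card_filter_block M hEven (fun _ => 0) h0lt
  calc (∑ x' : TorusSite 2 M, ∑ y' : TorusSite 2 M,
        if (∀ i : Fin 2, (x' i).val / 2 = (X i).val) ∧ (∀ i : Fin 2, (y' i).val / 2 = 0) then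
          (star ψ ⬝ᵥ Matrix.mulVec (onSite x' (spinRaise 1) * onSite y' (spinLower 1)) ψ).re
        else 0)
      ≤ ∑ x' : TorusSite 2 M, ∑ y' : TorusSite 2 M,
          if (∀ i : Fin 2, (x' i).val / 2 = (X i).val) ∧ (∀ i : Fin 2, (y' i).val / 2 = 0) then
            (1 / 2 : ℝ) else 0 := by
        refine Finset.sum_le_sum fun x' _ => Finset.sum_le_sum fun y' _ => ?_
        split_ifs
        · exact hK x' y'
        · exact le_rfl
    _ = ∑ x' : TorusSite 2 M, (if (∀ i : Fin 2, (x' i).val / 2 = (X i).val) then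
          ∑ y' : TorusSite 2 M, (if (∀ i : Fin 2, (y' i).val / 2 = 0) then (1 / 2 : ℝ) else 0)
          else 0) := by
        refine Finset.sum_congr rfl fun x' _ => ?_
        by_cases hx : ∀ i : Fin 2, (x' i).val / 2 = (X i).val
        · rw [if_pos hx]
          exact Finset.sum_congr rfl fun y' _ => by rw [if_congr (and_iff_right hx) rfl rfl]
        · rw [if_neg hx]
          exact Finset.sum_eq_zero fun y' _ => by rw [if_neg (fun h => hx h.1)]
    _ = 4 * (4 * (1 / 2 : ℝ)) := by
        rw [Finset.sum_ite, Finset.sum_const_zero, add_zero, Finset.sum_const, hcardX,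
          Finset.sum_ite, Finset.sum_const_zero, add_zero, Finset.sum_const, hcard0]
        simp only [nsmul_eq_mul]
        norm_num
    _ = 8 := by norm_num

/-- **Local log-coherence from a nearest-neighbour lower bound** (input (b) in kernel form): if the
coarse block kernel of a half-filled ground state satisfies `k₂(Z) ≥ ℓ > 0` for the displacements
`Z ∈ D`, then `Σ_{Z∈D} (log k₂(0) - log k₂(Z)) ≤ |D| · (log 8 - log ℓ)` (`k₂(0) ≤ 8`,
`coarseKernel_le_eight`; `k₂ > 0`, `coarseKernel_pos`). [folklore] -/
theorem local_logCoherence_le_of_lower (hM : M = 2 * m) (hEven : Even M) (h4 : 4 ≤ M) (Δ : ℝ)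
    (ψ : TensorIndex (TorusSite 2 M) 2 → ℂ)
    (hψ : ψ ∈ @spinZSector (TorusSite 2 M) _ _ 1 0) (hnorm : star ψ ⬝ᵥ ψ = 1)
    (heig : Matrix.mulVec (xxzHamiltonian 1 (torusGraph 2 M) (-1) Δ) ψ =
      ((lowestEnergyInSector 1 (xxzHamiltonian 1 (torusGraph 2 M) (-1) Δ) 0 : ℝ) : ℂ) • ψ)
    (D : Finset (TorusSite 2 m)) {ℓ : ℝ} (hℓ : 0 < ℓ)
    (hlow : ∀ Z ∈ D, ℓ ≤ ∑ x' : TorusSite 2 M, ∑ y' : TorusSite 2 M,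
      if (∀ i : Fin 2, (x' i).val / 2 = (Z i).val) ∧ (∀ i : Fin 2, (y' i).val / 2 = 0) then
        (star ψ ⬝ᵥ Matrix.mulVec (onSite x' (spinRaise 1) * onSite y' (spinLower 1)) ψ).re
      else 0) :
    ∑ Z ∈ D, (Real.log (∑ x' : TorusSite 2 M, ∑ y' : TorusSite 2 M,
        if (∀ i : Fin 2, (x' i).val / 2 = ((0 : TorusSite 2 m) i).val) ∧
            (∀ i : Fin 2, (y' i).val / 2 = 0) then
          (star ψ ⬝ᵥ Matrix.mulVec (onSite x' (spinRaise 1) * onSite y' (spinLower 1)) ψ).re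
        else 0) -
      Real.log (∑ x' : TorusSite 2 M, ∑ y' : TorusSite 2 M,
        if (∀ i : Fin 2, (x' i).val / 2 = (Z i).val) ∧ (∀ i : Fin 2, (y' i).val / 2 = 0) then
          (star ψ ⬝ᵥ Matrix.mulVec (onSite x' (spinRaise 1) * onSite y' (spinLower 1)) ψ).re
        else 0)) ≤ D.card * (Real.log 8 - Real.log ℓ) := by
  set k₂ : TorusSite 2 m → ℝ := fun X => ∑ x' : TorusSite 2 M, ∑ y' : TorusSite 2 M,
      if (∀ i : Fin 2, (x' i).val / 2 = (X i).val) ∧ (∀ i : Fin 2, (y' i).val / 2 = 0) then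
        (star ψ ⬝ᵥ Matrix.mulVec (onSite x' (spinRaise 1) * onSite y' (spinLower 1)) ψ).re
      else 0 with hk₂
  have hk0 : k₂ 0 = ∑ x' : TorusSite 2 M, ∑ y' : TorusSite 2 M,
      if (∀ i : Fin 2, (x' i).val / 2 = ((0 : TorusSite 2 m) i).val) ∧
          (∀ i : Fin 2, (y' i).val / 2 = 0) then
        (star ψ ⬝ᵥ Matrix.mulVec (onSite x' (spinRaise 1) * onSite y' (spinLower 1)) ψ).re
      else 0 := rfl
  rw [← hk0]
  have h8 : k₂ 0 ≤ 8 := coarseKernel_le_eight M hM hEven Δ ψ hψ hnorm heig 0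
  have hpos0 : 0 < k₂ 0 := coarseKernel_pos M hM hEven h4 Δ ψ hψ hnorm heig 0
  have hterm : ∀ Z ∈ D, Real.log (k₂ 0) - Real.log (k₂ Z) ≤ Real.log 8 - Real.log ℓ := by
    intro Z hZ
    have h1 : Real.log (k₂ 0) ≤ Real.log 8 := Real.log_le_log hpos0 h8
    have h2 : Real.log ℓ ≤ Real.log (k₂ Z) := Real.log_le_log hℓ (hlow Z hZ)
    linarith
  calc ∑ Z ∈ D, (Real.log (k₂ 0) - Real.log (k₂ Z))
      ≤ ∑ _Z ∈ D, (Real.log 8 - Real.log ℓ) := Finset.sum_le_sum hterm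
    _ = D.card * (Real.log 8 - Real.log ℓ) := by rw [Finset.sum_const, nsmul_eq_mul]

/-- **The Lévy mass under a pointwise anchor** (input (c) in kernel form): if the coarse block
kernel of a half-filled ground state satisfies `k₂(X) ≥ c₀ > 0` for EVERY coarse site `X`, then the
skeleton's Lévy mass is at most `log 8 - log c₀` (each term `log k₂(0) - log k₂(X)` of the coarse
mean is `≤ log 8 - log c₀`; `levyMass_fine_eq_coarse`). [folklore] -/
theorem levyMass_le_of_pointwise_lower (hM : M = 2 * m) (hEven : Even M) (h4 : 4 ≤ M) (Δ : ℝ)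
    (ψ : TensorIndex (TorusSite 2 M) 2 → ℂ)
    (hψ : ψ ∈ @spinZSector (TorusSite 2 M) _ _ 1 0) (hnorm : star ψ ⬝ᵥ ψ = 1)
    (heig : Matrix.mulVec (xxzHamiltonian 1 (torusGraph 2 M) (-1) Δ) ψ =
      ((lowestEnergyInSector 1 (xxzHamiltonian 1 (torusGraph 2 M) (-1) Δ) 0 : ℝ) : ℂ) • ψ)
    {c₀ : ℝ} (hc₀ : 0 < c₀)
    (hlow : ∀ X : TorusSite 2 m, c₀ ≤ ∑ x' : TorusSite 2 M, ∑ y' : TorusSite 2 M,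
      if (∀ i : Fin 2, (x' i).val / 2 = (X i).val) ∧ (∀ i : Fin 2, (y' i).val / 2 = 0) then
        (star ψ ⬝ᵥ Matrix.mulVec (onSite x' (spinRaise 1) * onSite y' (spinLower 1)) ψ).re
      else 0) :
    (∑ x : TorusSite 2 M, -Real.log ((∑ x' : TorusSite 2 M, ∑ y' : TorusSite 2 M,
        if (∀ i : Fin 2, (x' i).val / 2 = (x i).val / 2) ∧
          (∀ i : Fin 2, (y' i).val / 2 = ((0 : TorusSite 2 M) i).val / 2)
        then (star ψ ⬝ᵥ Matrix.mulVec (onSite x' (spinRaise 1) * onSite y' (spinLower 1)) ψ).re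
        else 0) /
      (∑ x' : TorusSite 2 M, ∑ y' : TorusSite 2 M,
        if (∀ i : Fin 2, (x' i).val / 2 = ((0 : TorusSite 2 M) i).val / 2) ∧
          (∀ i : Fin 2, (y' i).val / 2 = ((0 : TorusSite 2 M) i).val / 2)
        then (star ψ ⬝ᵥ Matrix.mulVec (onSite x' (spinRaise 1) * onSite y' (spinLower 1)) ψ).re
        else 0))) / (M : ℝ) ^ 2 ≤ Real.log 8 - Real.log c₀ := by
  rw [levyMass_fine_eq_coarse M hM hEven h4 Δ ψ hψ hnorm heig]
  set k₂ : TorusSite 2 m → ℝ := fun X => ∑ x' : TorusSite 2 M, ∑ y' : TorusSite 2 M,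
      if (∀ i : Fin 2, (x' i).val / 2 = (X i).val) ∧ (∀ i : Fin 2, (y' i).val / 2 = 0) then
        (star ψ ⬝ᵥ Matrix.mulVec (onSite x' (spinRaise 1) * onSite y' (spinLower 1)) ψ).re
      else 0 with hk₂
  have hk0 : k₂ 0 = ∑ x' : TorusSite 2 M, ∑ y' : TorusSite 2 M,
      if (∀ i : Fin 2, (x' i).val / 2 = ((0 : TorusSite 2 m) i).val) ∧
          (∀ i : Fin 2, (y' i).val / 2 = 0) then
        (star ψ ⬝ᵥ Matrix.mulVec (onSite x' (spinRaise 1) * onSite y' (spinLower 1)) ψ).re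
      else 0 := rfl
  rw [← hk0]
  have h8 : k₂ 0 ≤ 8 := coarseKernel_le_eight M hM hEven Δ ψ hψ hnorm heig 0
  have hpos0 : 0 < k₂ 0 := coarseKernel_pos M hM hEven h4 Δ ψ hψ hnorm heig 0
  have hterm : ∀ X : TorusSite 2 m, Real.log (k₂ 0) - Real.log (k₂ X) ≤ Real.log 8 - Real.log c₀ := by
    intro X
    have h1 : Real.log (k₂ 0) ≤ Real.log 8 := Real.log_le_log hpos0 h8
    have h2 : Real.log c₀ ≤ Real.log (k₂ X) := Real.log_le_log hc₀ (hlow X)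
    linarith
  have hm0 : (0 : ℝ) < ((m : ℕ) : ℝ) ^ 2 := by
    have : (0 : ℝ) < (m : ℝ) := Nat.cast_pos.2 (Nat.pos_of_ne_zero (NeZero.ne m))
    positivity
  rw [div_le_iff₀ hm0]
  calc ∑ X : TorusSite 2 m, (Real.log (k₂ 0) - Real.log (k₂ X))
      ≤ ∑ _X : TorusSite 2 m, (Real.log 8 - Real.log c₀) := Finset.sum_le_sum fun X _ => hterm X
    _ = (Real.log 8 - Real.log c₀) * ((m : ℕ) : ℝ) ^ 2 := by
        rw [Finset.sum_const, Finset.card_univ, nsmul_eq_mul]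
        have : (Fintype.card (TorusSite 2 m) : ℝ) = ((m : ℕ) : ℝ) ^ 2 := by
          have hc : Fintype.card (TorusSite 2 m) = m ^ 2 := by
            show Fintype.card (Fin 2 → ZMod m) = m ^ 2
            rw [Fintype.card_fun, ZMod.card, Fintype.card_fin]
          rw [hc]
          push_cast
          ring
        rw [this, mul_comm]

end Bounds

/-! ### `stub_logBootstrap` from its physical inputs -/

/-- **`logBootstrap_explicit_of_inputs` — THE LOG-BOOTSTRAP STUB FROM ITS LAYER-2 INPUTS** (the
body of `stub_logBootstrap`, abbreviations unfolded, at a fixed `Δ₁ ∈ (-1, 0]`): with the UV set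
`S_M = {q ≠ 0 : ∃ i, Re χ_q(e_i) ≤ t}` (`t < 1`), displacements `{e₁, e₂}` and `c = 1 - t`, the inputs
(a) infrared wing `≤ β₀`, (b) local log-coherence `≤ U₀`, (c) anchor `levyMass ≤ U₀ + 1` at `Δ = 0`
(all for even `M ≥ M₀`) and (d) `β₀ e^{U₀+1} < 1` give, under `Block2InfDivXXZ`, the conclusion of
`stub_logBootstrap` at `Δ₁` with `U = U₀`, `β = β₀`, `M₀ ↦ max M₀ 4` (`stub_levyBootstrapShape` and
monotonicity in `U`, `β`). [folklore] -/
theorem logBootstrap_explicit_of_inputs :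
    Summit.HubbardSuperconductivity.HubbardSuperconductivity.Theses.LevyLogBootstrap.Block2InfDivXXZ →
    ∀ Δ₁ ∈ Set.Ioc (-1:ℝ) 0, ∀ (t U₀ β₀ : ℝ) (M₀ : ℕ), t < 1 → 0 ≤ β₀ → β₀ * Real.exp (U₀ + 1) < 1 →
      (∀ (M : ℕ) [NeZero M] [NeZero (M / 2)], Even M → M₀ ≤ M → ∀ Δ ∈ Set.Icc Δ₁ 0,
        ∀ ψ : TensorIndex (TorusSite 2 M) 2 → ℂ,
        (ψ ∈ @spinZSector (TorusSite 2 M) _ _ 1 0 ∧ star ψ ⬝ᵥ ψ = 1 ∧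
          Matrix.mulVec (xxzHamiltonian 1 (torusGraph 2 M) (-1) Δ) ψ =
            ((lowestEnergyInSector 1 (xxzHamiltonian 1 (torusGraph 2 M) (-1) Δ) 0 : ℝ) : ℂ) • ψ) →
        (∑ q ∈ (Finset.univ.erase 0) \
              (Finset.univ.filter (fun q : TorusSite 2 (M / 2) => q ≠ 0 ∧
                ∃ i : Fin 2, (torusChar q (Pi.single i 1)).re ≤ t)),
            ∑ X : TorusSite 2 (M / 2),
            (∑ x' : TorusSite 2 M, ∑ y' : TorusSite 2 M,
              if (∀ i : Fin 2, (x' i).val / 2 = (X i).val) ∧ (∀ i : Fin 2, (y' i).val / 2 = 0) then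
                (star ψ ⬝ᵥ Matrix.mulVec
                  (onSite x' (spinRaise 1) * onSite y' (spinLower 1)) ψ).re
              else 0) * (torusChar q X).re) /
          ((((M / 2 : ℕ)) : ℝ) ^ 2 * (∑ x' : TorusSite 2 M, ∑ y' : TorusSite 2 M,
              if (∀ i : Fin 2, (x' i).val / 2 = ((0 : TorusSite 2 (M / 2)) i).val) ∧
                (∀ i : Fin 2, (y' i).val / 2 = 0) then
                (star ψ ⬝ᵥ Matrix.mulVec
                  (onSite x' (spinRaise 1) * onSite y' (spinLower 1)) ψ).re
              else 0)) ≤ β₀ ∧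
        (∑ Z ∈ Finset.univ.image (fun i : Fin 2 => (Pi.single i 1 : TorusSite 2 (M / 2))),
            (Real.log (∑ x' : TorusSite 2 M, ∑ y' : TorusSite 2 M,
              if (∀ i : Fin 2, (x' i).val / 2 = ((0 : TorusSite 2 (M / 2)) i).val) ∧
                (∀ i : Fin 2, (y' i).val / 2 = 0) then
                (star ψ ⬝ᵥ Matrix.mulVec
                  (onSite x' (spinRaise 1) * onSite y' (spinLower 1)) ψ).re
              else 0) -
            Real.log (∑ x' : TorusSite 2 M, ∑ y' : TorusSite 2 M,
              if (∀ i : Fin 2, (x' i).val / 2 = (Z i).val) ∧ (∀ i : Fin 2, (y' i).val / 2 = 0) then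
                (star ψ ⬝ᵥ Matrix.mulVec
                  (onSite x' (spinRaise 1) * onSite y' (spinLower 1)) ψ).re
              else 0))) / (1 - t) ≤ U₀) →
      (∀ (M : ℕ) [NeZero M], Even M → M₀ ≤ M →
        ∀ ψ : TensorIndex (TorusSite 2 M) 2 → ℂ,
        (ψ ∈ @spinZSector (TorusSite 2 M) _ _ 1 0 ∧ star ψ ⬝ᵥ ψ = 1 ∧
          Matrix.mulVec (xxzHamiltonian 1 (torusGraph 2 M) (-1) 0) ψ =
            ((lowestEnergyInSector 1 (xxzHamiltonian 1 (torusGraph 2 M) (-1) 0) 0 : ℝ) : ℂ) • ψ) →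
        (∑ x : TorusSite 2 M, -Real.log ((∑ x' : TorusSite 2 M, ∑ y' : TorusSite 2 M,
            if (∀ i : Fin 2, (x' i).val / 2 = (x i).val / 2) ∧
              (∀ i : Fin 2, (y' i).val / 2 = ((0 : TorusSite 2 M) i).val / 2)
            then (star ψ ⬝ᵥ Matrix.mulVec (onSite x' (spinRaise 1) * onSite y' (spinLower 1)) ψ).re
            else 0) /
          (∑ x' : TorusSite 2 M, ∑ y' : TorusSite 2 M,
            if (∀ i : Fin 2, (x' i).val / 2 = ((0 : TorusSite 2 M) i).val / 2) ∧
              (∀ i : Fin 2, (y' i).val / 2 = ((0 : TorusSite 2 M) i).val / 2)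
            then (star ψ ⬝ᵥ Matrix.mulVec (onSite x' (spinRaise 1) * onSite y' (spinLower 1)) ψ).re
            else 0))) / (M : ℝ) ^ 2 ≤ U₀ + 1) →
      ∃ U β : ℝ, 0 ≤ β ∧ β * Real.exp (U + 1) < 1 ∧
        ∃ M₁ : ℕ, ∀ (M : ℕ) [NeZero M], Even M → M₁ ≤ M →
          (∀ Δ ∈ Set.Icc Δ₁ 0, ∀ ψ : TensorIndex (TorusSite 2 M) 2 → ℂ,
            (ψ ∈ @spinZSector (TorusSite 2 M) _ _ 1 0 ∧ star ψ ⬝ᵥ ψ = 1 ∧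
              Matrix.mulVec (xxzHamiltonian 1 (torusGraph 2 M) (-1) Δ) ψ =
                ((lowestEnergyInSector 1 (xxzHamiltonian 1 (torusGraph 2 M) (-1) Δ) 0 : ℝ) : ℂ) • ψ) →
            (∑ x : TorusSite 2 M, -Real.log ((∑ x' : TorusSite 2 M, ∑ y' : TorusSite 2 M,
                if (∀ i : Fin 2, (x' i).val / 2 = (x i).val / 2) ∧
                  (∀ i : Fin 2, (y' i).val / 2 = ((0 : TorusSite 2 M) i).val / 2)
                then (star ψ ⬝ᵥ Matrix.mulVec (onSite x' (spinRaise 1) * onSite y' (spinLower 1)) ψ).re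
                else 0) /
              (∑ x' : TorusSite 2 M, ∑ y' : TorusSite 2 M,
                if (∀ i : Fin 2, (x' i).val / 2 = ((0 : TorusSite 2 M) i).val / 2) ∧
                  (∀ i : Fin 2, (y' i).val / 2 = ((0 : TorusSite 2 M) i).val / 2)
                then (star ψ ⬝ᵥ Matrix.mulVec (onSite x' (spinRaise 1) * onSite y' (spinLower 1)) ψ).re
                else 0))) / (M : ℝ) ^ 2 ≤
            U + β * Real.exp ((∑ x : TorusSite 2 M, -Real.log ((∑ x' : TorusSite 2 M, ∑ y' : TorusSite 2 M,
                if (∀ i : Fin 2, (x' i).val / 2 = (x i).val / 2) ∧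
                  (∀ i : Fin 2, (y' i).val / 2 = ((0 : TorusSite 2 M) i).val / 2)
                then (star ψ ⬝ᵥ Matrix.mulVec (onSite x' (spinRaise 1) * onSite y' (spinLower 1)) ψ).re
                else 0) /
              (∑ x' : TorusSite 2 M, ∑ y' : TorusSite 2 M,
                if (∀ i : Fin 2, (x' i).val / 2 = ((0 : TorusSite 2 M) i).val / 2) ∧
                  (∀ i : Fin 2, (y' i).val / 2 = ((0 : TorusSite 2 M) i).val / 2)
                then (star ψ ⬝ᵥ Matrix.mulVec (onSite x' (spinRaise 1) * onSite y' (spinLower 1)) ψ).re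
                else 0))) / (M : ℝ) ^ 2)) ∧
          (∀ ψ : TensorIndex (TorusSite 2 M) 2 → ℂ,
            (ψ ∈ @spinZSector (TorusSite 2 M) _ _ 1 0 ∧ star ψ ⬝ᵥ ψ = 1 ∧
              Matrix.mulVec (xxzHamiltonian 1 (torusGraph 2 M) (-1) 0) ψ =
                ((lowestEnergyInSector 1 (xxzHamiltonian 1 (torusGraph 2 M) (-1) 0) 0 : ℝ) : ℂ) • ψ) →
            (∑ x : TorusSite 2 M, -Real.log ((∑ x' : TorusSite 2 M, ∑ y' : TorusSite 2 M,
                if (∀ i : Fin 2, (x' i).val / 2 = (x i).val / 2) ∧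
                  (∀ i : Fin 2, (y' i).val / 2 = ((0 : TorusSite 2 M) i).val / 2)
                then (star ψ ⬝ᵥ Matrix.mulVec (onSite x' (spinRaise 1) * onSite y' (spinLower 1)) ψ).re
                else 0) /
              (∑ x' : TorusSite 2 M, ∑ y' : TorusSite 2 M,
                if (∀ i : Fin 2, (x' i).val / 2 = ((0 : TorusSite 2 M) i).val / 2) ∧
                  (∀ i : Fin 2, (y' i).val / 2 = ((0 : TorusSite 2 M) i).val / 2)
                then (star ψ ⬝ᵥ Matrix.mulVec (onSite x' (spinRaise 1) * onSite y' (spinLower 1)) ψ).re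
                else 0))) / (M : ℝ) ^ 2 ≤ U + 1) := by
  intro hK1 Δ₁ hΔ₁ t U₀ β₀ M₀ ht hβ₀ hnum hInputs hAnchor
  refine ⟨U₀, β₀, hβ₀, hnum, max M₀ 4, fun M _ hEven hM₁ => ⟨?_, ?_⟩⟩
  · intro Δ hΔ ψ hgs
    obtain ⟨hψ, hnorm, heig⟩ := hgs
    have hM₀ : M₀ ≤ M := le_of_max_le_left hM₁
    have h4 : 4 ≤ M := le_of_max_le_right hM₁
    haveI : NeZero (M / 2) := ⟨by omega⟩
    classical
    have hΔ' : Δ ∈ Set.Icc (-1:ℝ) 0 := ⟨le_trans hΔ₁.1.le hΔ.1, hΔ.2⟩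
    -- the Lévy hypothesis from `Block2InfDivXXZ`
    have hA := levyCoeff_nonneg_of_Block2InfDivXXZ hK1 M hEven h4 Δ hΔ' ψ hψ hnorm heig
    -- the UV set, the displacements, the constant
    set S : Finset (TorusSite 2 (M / 2)) := Finset.univ.filter
      (fun q : TorusSite 2 (M / 2) => q ≠ 0 ∧ ∃ i : Fin 2, (torusChar q (Pi.single i 1)).re ≤ t)
      with hS
    set D : Finset (TorusSite 2 (M / 2)) :=
      Finset.univ.image (fun i : Fin 2 => (Pi.single i 1 : TorusSite 2 (M / 2))) with hD
    have hSne : ∀ q ∈ S, q ≠ 0 := fun q hq => ((Finset.mem_filter.1 hq).2).1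
    have hc : (0 : ℝ) < 1 - t := by linarith
    have hcS : ∀ q ∈ S, 1 - t ≤ ∑ Z ∈ D, (1 - (torusChar q Z).re) := by
      intro q hq
      obtain ⟨i, hi⟩ := ((Finset.mem_filter.1 hq).2).2
      have hmem : (Pi.single i 1 : TorusSite 2 (M / 2)) ∈ D :=
        Finset.mem_image.2 ⟨i, Finset.mem_univ _, rfl⟩
      have hnn : ∀ Z ∈ D, 0 ≤ 1 - (torusChar q Z).re := fun Z _ =>
        sub_nonneg.2 (TorusLevyKhintchine.re_torusChar_le_one q Z)
      calc 1 - t ≤ 1 - (torusChar q (Pi.single i 1)).re := by linarith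
        _ ≤ ∑ Z ∈ D, (1 - (torusChar q Z).re) := Finset.single_le_sum hnn hmem
    have hshape := stub_levyBootstrapShape M hEven h4 Δ ψ hψ hnorm heig hA S D (1 - t) hSne hc hcS
    obtain ⟨hIR, hLoc⟩ := hInputs M hEven hM₀ Δ hΔ ψ ⟨hψ, hnorm, heig⟩
    -- monotonicity in `U` and `β`
    refine hshape.trans (add_le_add hLoc ?_)
    exact mul_le_mul_of_nonneg_right hIR (Real.exp_pos _).le
  · intro ψ hgs
    exact hAnchor M hEven (le_of_max_le_left hM₁) ψ hgs

end Summit.HubbardSuperconductivity.HubbardSuperconductivity.Theorems.LevyLogBootstrap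

end
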